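import Mathlib
import HarnessLib
import Summits.HubbardSuperconductivity.HubbardSuperconductivity.Theorems.KLProgrammeKLRegimeEngineTowerInstRemeasureLev
import Summits.HubbardSuperconductivity.HubbardSuperconductivity.Theorems.KLProgrammeKLRegimeEngineTowerRemeasureLevBase

/-!
# Route `KLProgramme` — crux K3 ENGINE (stmt-HubbardSuperconductivity-20437 `KLRegimeEngineV17F2`), stub (b) v2, THE LEVELS PACKAGE (ℓ), instantiation (I2):
# THE RE-BASED `hμ` SUMMANDS IN KIT UNITS — base `𝒱_d` at `F_{d−1}` instead of `𝒱_0` at `F_0` (cure (A″) of located-risk #8 «(ℓ)-BLOCK0-LOGM»;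
# cell gate-hubbard-kl, seat p4 g19; base twin of …TowerInstRemeasureLev (k3c2-p3 g10/g11, p4 g17))

`klTowerMuLevAt_le_kitSum` (…InstRemeasureLev) divides the absolute re-measurement row by the track's unit at `F_{dk−1}` and reads a UV term
`((√2)^{2p+t−6})⁻¹^{dk−1}·N₀/unit_t(p, 0)` from the level-`0` carriers.  Its base twin reads instead the BASE datum `N_b` = a bound of the levelled norms of
`𝒱_d = klTowerInput … d 1` at `F_{d−1}`, jumped by `d(k−1)` families:

* §1 `baseSummand_div_klLevUnit_eq` — `(2^{(dk−1)−(d−1)})^{2p−1−F}·N_b / unit_t(p, dk−1) = ((√2)^{2p+t−6})⁻¹^{d(k−1)}·(N_b / unit_t(p, d−1))`;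
* §2 **`klTowerMuLevAt_le_kitSum_base`** — for `d ≥ 2`, `k ≥ 2`, every track `t`, `t + 2 ≤ 2p`, `6 ≤ 2p + t`:
  `klTowerMuLevAt … d t k p ≤ 27^{t+1}·C₁C₂^{2p−1}·( ((√2)^{2p+t−6})⁻¹^{d(k−1)}·N_b/unit_t(p,d−1) + Σ_{1≤k′<k} (√2)^{2p+t−6}·(((√2)^d)⁻¹)^{(2p+t−6)(k−k′)}·klTowerBLev … d t (k′+1) p )`.
Compositions of landed theorems and real algebra; nothing about the model is asserted beyond them; nothing asserts (ℓ), any stub, K3 or superconductivity.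
References: BGM 2006 §2.8 (2.83), (2.93)–(2.98) [cite: BenfattoGiulianiMastropietro2006].
-/

noncomputable section

namespace Summit.HubbardSuperconductivity.HubbardSuperconductivity.Theorems.EngineV8

set_option linter.dupNamespace false -- summit = problem name (single-conjunct summit), D-0017

open Classical
open Real Finset Literature.MathematicalPhysics.QuantumLattice Literature.Probability.LatticeModels GrassmannAlgebra
open Literature.MathematicalPhysics.QuantumLattice.FermiRG
open Summit.HubbardSuperconductivity.HubbardSuperconductivity.Theorems.KLProgrammeLegKernels
open Summit.HubbardSuperconductivity.HubbardSuperconductivity.Theorems.KLRegimeSplit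
open Summit.HubbardSuperconductivity.HubbardSuperconductivity.Theorems.KLRegimeWick
open Summit.HubbardSuperconductivity.HubbardSuperconductivity.Theorems.TorusFourierL2
open Summit.HubbardSuperconductivity.HubbardSuperconductivity.Theorems.DispersionFlow
open Summit.HubbardSuperconductivity.HubbardSuperconductivity.Theorems.PerturbedFermiCurve

variable {L M : ℕ} [NeZero L] [NeZero M]

/-! ## §1 The base summand in kit units -/

omit [NeZero L] in
/-- **The base summand in kit units**: for `1 ≤ d`, `1 ≤ k`,
`(2^{(dk−1)−(d−1)})^{2p−1−F}·N_b / klLevUnit … t p (dk−1) = ((√2)^{2p+t−6})⁻¹^{d(k−1)}·(N_b / klLevUnit … t p (d−1))`. -/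
theorem baseSummand_div_klLevUnit_eq {β : ℝ} (hβ : 0 < β) {d k p : ℕ} (hd : 1 ≤ d) (hk : 1 ≤ k) (t : Fin 5)
    (h1 : (t : ℕ) + 2 ≤ 2 * p) (h2 : 6 ≤ 2 * p + (t : ℕ)) (Nb : ℝ) :
    ((2 : ℝ) ^ (d * k - 1 - (d - 1))) ^ (2 * p - 1 - ((t : ℕ) + 1)) * Nb / klLevUnit β M t p (d * k - 1) =
      (Real.sqrt 2 ^ (2 * p + (t : ℕ) - 6))⁻¹ ^ (d * (k - 1)) * (Nb / klLevUnit β M t p (d - 1)) := by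
  have hu0 : 0 < klLevUnit β M t p (d - 1) := klLevUnit_pos hβ t p _
  have hr0 : 0 < klLevRatio t p := klLevRatio_pos t p
  have hdk : d * (k - 1) = d * k - d := by rw [Nat.mul_sub, Nat.mul_one]
  have hdle : d ≤ d * k := Nat.le_mul_of_pos_right d (by omega)
  have hΔ : d * k - 1 - (d - 1) = d * (k - 1) := by omega
  have hsplit : d * k - 1 = (d - 1) + d * (k - 1) := by omega
  rw [hΔ, hsplit, klLevUnit_add, show 2 * p - 1 - ((t : ℕ) + 1) = 2 * p - 2 - (t : ℕ) by omega, ← pow_mul,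
    mul_comm (d * (k - 1)), pow_mul, ← jump_div_klLevRatio_eq t h1 h2, div_pow]
  field_simp

/-! ## §2 The re-based levelled re-measurement row in kit units -/

omit [NeZero L] [NeZero M] in
/-- **THE RE-BASED `hμ` SUMMANDS OF THE LEVELLED TRACK IN KIT UNITS**: `C₁, C₂` and the thresholds fixed before the degree; for every track `t : Fin 5` and
half-degree `p` with `t + 2 ≤ 2p`, `6 ≤ 2p + t`, `d ≥ 2`, `k ≥ 2`, `dk − 1 ≤ nScales β + 1`, and every bound `N_b` of the levelled norms of the base `𝒱_d` at `F_{d−1}`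
of level `t + 1` in degree `2p`:
`klTowerMuLevAt … d t k p ≤ 27^{t+1}·C₁·C₂^{2p−1}·( ((√2)^{2p+t−6})⁻¹^{d(k−1)}·N_b/unit_t(p,d−1) + Σ_{1≤k′<k} (√2)^{2p+t−6}·(((√2)^d)⁻¹)^{(2p+t−6)(k−k′)}·klTowerBLev … d t (k′+1) p )`.
[cite: BenfattoGiulianiMastropietro2006, §2.8 (2.83), (2.93)-(2.98)] -/
theorem klTowerMuLevAt_le_kitSum_base :
    ∃ C₁ C₂ : ℝ, 0 < C₁ ∧ 0 < C₂ ∧ ∀ R : RenConsts, R.WF2 → ∃ c₃' : ℝ, 0 < c₃' ∧ ∃ U₀' : ℝ, 0 < U₀' ∧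
      ∀ (P : SplitConsts) (c : ℝ), P.WF → 0 < c → c ≤ klEngC₃6 P R → c ≤ c₃' →
      ∀ μ ∈ klWindowC, ∀ U : ℝ, 0 < U → U ≤ klEngU₀9 P R c → U ≤ U₀' → ∀ β : ℝ, klBetaMin ≤ β → β ≤ Real.exp (c / U ^ 2) →
      ∀ K : TrigPolyC4v, FrameOK R U (nScales β) μ K → ∀ (L M : ℕ) [NeZero L] [NeZero M],
      klEngL₃ β U ≤ L → klEngM₃ β U L ≤ M → ∀ d k : ℕ, 2 ≤ d → 2 ≤ k → d * k - 1 ≤ nScales β + 1 →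
      ∀ (t : Fin 5) (p : ℕ), (t : ℕ) + 2 ≤ 2 * p → 6 ≤ 2 * p + (t : ℕ) → ∀ Nb : ℝ, 0 ≤ Nb →
        (∀ Ωe' : Fin (2 * p) → Option (SectorLeg (sectorCount (d - 1))), levelCount Ωe' = (t : ℕ) + 1 →
          klLevNormOf L M β μ K (d - 1) (2 * p) (klTowerInput L M β U μ K d 1) Ωe' ≤ Nb) →
        klTowerMuLevAt L M β U μ K d t k p ≤
          (27 : ℝ) ^ ((t : ℕ) + 1) * (C₁ * C₂ ^ (2 * p - 1)) *
            ((Real.sqrt 2 ^ (2 * p + (t : ℕ) - 6))⁻¹ ^ (d * (k - 1)) * (Nb / klLevUnit β M t p (d - 1)) +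
              ∑ k' ∈ Ico 1 k, Real.sqrt 2 ^ (2 * p + (t : ℕ) - 6) * ((Real.sqrt 2 ^ d)⁻¹) ^ ((2 * p + (t : ℕ) - 6) * (k - k')) *
                klTowerBLev L M β U μ K d t (k' + 1) p) := by
  obtain ⟨C₁, C₂, hC₁, hC₂, h⟩ := klTowerMeasLev_le_base_add_sum_bornLev_klEng_uniform
  refine ⟨C₁, C₂, hC₁, hC₂, fun R hR2 => ?_⟩
  obtain ⟨c₃, hc₃, U₀, hU₀, h'⟩ := h R hR2
  refine ⟨c₃, hc₃, U₀, hU₀, ?_⟩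
  intro P c hP hc hc6 hc₃' μ hμ U hU hU9 hU₀' β hβmin hβc K hK L M _ _ hL3 hM3 d k hd hk2 hkN t p h1 h2 Nb hN0 hN
  have hβ : 0 < β := KLRegimeSplit.pos_of_klBetaMin_le hβmin
  have hp1 : 1 ≤ 2 * p := by omega
  have hu : 0 < klLevUnit β M t p (d * k - 1) := klLevUnit_pos hβ t p _
  -- the absolute row at `m + 1 = 2p` legs, level `F = t + 1`
  have hN' : ∀ Ωe' : Fin (2 * p - 1 + 1) → Option (SectorLeg (sectorCount (d - 1))), levelCount Ωe' = (t : ℕ) + 1 →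
      klLevNormOf L M β μ K (d - 1) (2 * p - 1 + 1) (klTowerInput L M β U μ K d 1) Ωe' ≤ Nb := by
    rw [show 2 * p - 1 + 1 = 2 * p by omega]; exact hN
  have hrow := h' (2 * p - 1) P c hP hc hc6 hc₃' μ hμ U hU hU9 hU₀' β hβmin hβc K hK L M hL3 hM3 d k hd hk2 hkN ((t : ℕ) + 1) Nb hN0 hN'
  rw [show 2 * p - 1 + 1 = 2 * p by omega] at hrow
  -- divide by the unit and convert every summand
  unfold klTowerMuLevAt
  rw [div_le_iff₀ hu]
  have hborn : ∀ k' ∈ Ico 1 k, C₁ * C₂ ^ (2 * p - 1) * ((2 : ℝ) ^ (d * k - 1 - d * k')) ^ (2 * p - 1 - ((t : ℕ) + 1)) *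
      klTowerBornLev L M β U μ K d k' (2 * p) ((t : ℕ) + 1) =
      C₁ * C₂ ^ (2 * p - 1) * (Real.sqrt 2 ^ (2 * p + (t : ℕ) - 6) * ((Real.sqrt 2 ^ d)⁻¹) ^ ((2 * p + (t : ℕ) - 6) * (k - k')) *
        klTowerBLev L M β U μ K d t (k' + 1) p) * klLevUnit β M t p (d * k - 1) := by
    intro k' hk'
    have hk'k : k' < k := (mem_Ico.1 hk').2
    have e := bornSummand_div_klLevUnit_eq (L := L) (M := M) hβ U μ K (by omega : 1 ≤ d) hk'k t h1 h2 (p := p)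
    rw [div_eq_iff hu.ne'] at e
    rw [mul_assoc (C₁ * C₂ ^ (2 * p - 1)), mul_assoc (C₁ * C₂ ^ (2 * p - 1)), e]
  have hbs : C₁ * C₂ ^ (2 * p - 1) * ((2 : ℝ) ^ (d * k - 1 - (d - 1))) ^ (2 * p - 1 - ((t : ℕ) + 1)) * Nb =
      C₁ * C₂ ^ (2 * p - 1) * ((Real.sqrt 2 ^ (2 * p + (t : ℕ) - 6))⁻¹ ^ (d * (k - 1)) * (Nb / klLevUnit β M t p (d - 1))) *
        klLevUnit β M t p (d * k - 1) := by
    have e := baseSummand_div_klLevUnit_eq (M := M) hβ (d := d) (k := k) (by omega) (by omega) t h1 h2 Nb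
    rw [div_eq_iff hu.ne'] at e
    rw [mul_assoc (C₁ * C₂ ^ (2 * p - 1)), mul_assoc (C₁ * C₂ ^ (2 * p - 1)), e]
  rw [sum_congr rfl hborn, hbs, ← sum_mul] at hrow
  have hS0 : 0 ≤ C₁ * C₂ ^ (2 * p - 1) * ((Real.sqrt 2 ^ (2 * p + (t : ℕ) - 6))⁻¹ ^ (d * (k - 1)) * (Nb / klLevUnit β M t p (d - 1))) +
      ∑ k' ∈ Ico 1 k, C₁ * C₂ ^ (2 * p - 1) * (Real.sqrt 2 ^ (2 * p + (t : ℕ) - 6) * ((Real.sqrt 2 ^ d)⁻¹) ^ ((2 * p + (t : ℕ) - 6) * (k - k')) *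
        klTowerBLev L M β U μ K d t (k' + 1) p) := by
    have : 0 < klLevUnit β M t p (d - 1) := klLevUnit_pos hβ t p _
    refine add_nonneg (by positivity) (sum_nonneg fun k' _ => mul_nonneg (by positivity) (mul_nonneg (by positivity) ?_))
    exact klTowerBLev_nonneg hβ U μ K d t (k' + 1) p
  calc (27 : ℝ) ^ ((t : ℕ) + 1) * klTowerMeasLev L M β U μ K d k (2 * p) ((t : ℕ) + 1)
      ≤ (27 : ℝ) ^ ((t : ℕ) + 1) * ((C₁ * C₂ ^ (2 * p - 1) * ((Real.sqrt 2 ^ (2 * p + (t : ℕ) - 6))⁻¹ ^ (d * (k - 1)) * (Nb / klLevUnit β M t p (d - 1))) +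
          ∑ k' ∈ Ico 1 k, C₁ * C₂ ^ (2 * p - 1) * (Real.sqrt 2 ^ (2 * p + (t : ℕ) - 6) * ((Real.sqrt 2 ^ d)⁻¹) ^ ((2 * p + (t : ℕ) - 6) * (k - k')) *
            klTowerBLev L M β U μ K d t (k' + 1) p)) * klLevUnit β M t p (d * k - 1)) := by
        refine mul_le_mul_of_nonneg_left ?_ (by positivity)
        rw [add_mul]; exact hrow
    _ = (27 : ℝ) ^ ((t : ℕ) + 1) * (C₁ * C₂ ^ (2 * p - 1)) *
          ((Real.sqrt 2 ^ (2 * p + (t : ℕ) - 6))⁻¹ ^ (d * (k - 1)) * (Nb / klLevUnit β M t p (d - 1)) +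
            ∑ k' ∈ Ico 1 k, Real.sqrt 2 ^ (2 * p + (t : ℕ) - 6) * ((Real.sqrt 2 ^ d)⁻¹) ^ ((2 * p + (t : ℕ) - 6) * (k - k')) *
              klTowerBLev L M β U μ K d t (k' + 1) p) * klLevUnit β M t p (d * k - 1) := by
        rw [← mul_sum]; ring

end Summit.HubbardSuperconductivity.HubbardSuperconductivity.Theorems.EngineV8

end
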